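import Mathlib
import Summits.Ventures.HodgeRepro.Tier4.Common.AdelicDefs

/-!
# Tier4/Line1/SecondCountableGA — (I1-h) of LINE L1: `U(W)(𝔸_k)` is second countable

Blind re-derivation cell `pub-hodge-repro`, Tier 4 (README §9–§10), seat t4-L1-p5 (prover, LINE L1, gen 0).
Registered statement: `Skeleton.lean` v0.11 (8aa1bd30fa4907d5…, 1154 l.) L716 `secondCountable_GA`, proved here EXACTLY
as typed (the statement does not depend on the skeleton version).  Chain: each completion `k_v` (finite or infinite
place) is separable — `k` is countable and dense — and has a countably generated uniformity, hence is second countable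
(`UniformSpace.secondCountable_of_separable`); the finite adele ring `Πʳ_v [k_v, 𝓞_v]` is second countable because the
places are countable (every non-zero prime of the Noetherian countable ring `𝓞_k` is the span of a finite set) and the
restricted product is the countable union of the open subspaces `Πʳ_[𝓟 Sᶜ]`, `S` finite, each embedded in the
second-countable product `∏_v k_v` (`secondCountableTopology_of_countable_cover`); then `𝔸_k`, `M₄(𝔸_k)`, `GL₄(𝔸_k)`
(embedded in `M₄ × M₄ᵐᵒᵖ`) and the subspace `U(W)(𝔸_k)`.  Also recorded: `SecondCountableTopology` of
`FiniteAdeleRing (𝓞 k) k`, of `AdeleRing (𝓞 k) k`, of `GL4 k`, `Countable (HeightOneSpectrum (𝓞 k))`, and the generic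
second countability of a restricted product over a countable index with open `A i`.

Nothing here says anything about the status of the Hodge conjecture for CM abelian varieties, which is NOT proved
(HC_CM is NOT proved by anyone in this repository).
-/

set_option autoImplicit false

noncomputable section

namespace Summit.Ventures.HodgeRepro.Tier4.Line1

open NumberField IsDedekindDomain HeightOneSpectrum Common Topology TopologicalSpace Filter

/-! ## Restricted products over a countable index are second countable -/

section RestrictedProduct

open scoped RestrictedProduct

variable {ι : Type*} [Countable ι] {R : ι → Type*} [∀ i, TopologicalSpace (R i)]
  [∀ i, SecondCountableTopology (R i)] {A : (i : ι) → Set (R i)}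

/-- A restricted product `Πʳ i, [R i, A i]` over a COUNTABLE index set with open `A i` and second-countable `R i` is
second countable: it is the countable union of the open subspaces `Πʳ_[𝓟 Sᶜ]` (`S` finite), each of which embeds
in the second-countable product `Π i, R i`. -/
theorem secondCountableTopology_restrictedProduct (hA : ∀ i, IsOpen (A i)) :
    SecondCountableTopology (Πʳ i, [R i, A i]) := by
  classical
  have hS : ∀ s : Finset ι, (cofinite : Filter ι) ≤ 𝓟 ((↑s : Set ι)ᶜ) := fun s => by
    rw [le_principal_iff, mem_cofinite, compl_compl]
    exact s.finite_toSet
  let U : Finset ι → Set (Πʳ i, [R i, A i]) := fun s => Set.range (RestrictedProduct.inclusion R A (hS s))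
  have hUo : ∀ s, IsOpen (U s) := fun s =>
    (RestrictedProduct.isOpenEmbedding_inclusion_principal hA (hS s)).isOpen_range
  haveI hUsc : ∀ s, SecondCountableTopology (U s) := fun s => by
    haveI : SecondCountableTopology (Πʳ i, [R i, A i]_[𝓟 ((↑s : Set ι)ᶜ)]) :=
      RestrictedProduct.isEmbedding_coe_of_principal.secondCountableTopology
    exact (RestrictedProduct.isEmbedding_inclusion_principal (hS s)).toHomeomorph.symm.isEmbedding
      |>.secondCountableTopology
  refine secondCountableTopology_of_countable_cover hUo ?_
  apply Set.eq_univ_of_forall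
  intro x
  have hx : {i | x i ∉ A i}.Finite := by
    have := x.2
    rwa [eventually_cofinite] at this
  refine Set.mem_iUnion.2 ⟨hx.toFinset, ?_⟩
  rw [Set.mem_range]
  refine RestrictedProduct.exists_inclusion_eq_of_eventually R A (hS hx.toFinset) ?_
  rw [eventually_principal]
  intro i hi
  by_contra h
  exact hi (by simpa using h)

end RestrictedProduct

/-! ## The completions, the adele ring, `GL₄(𝔸_k)` and `U(W)(𝔸_k)` -/

section Adeles

variable (k : Type) [Field k] [NumberField k]

/-- A number field is countable (a finite-dimensional `ℚ`-vector space). -/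
theorem countable_numberField' : Countable k := Finsupp.Countable.of_moduleFinite (R := ℚ)

/-- The completion of `k` at an infinite place is second countable (separable: `k` is countable and dense). -/
theorem secondCountable_infinitePlaceCompletion (w : InfinitePlace k) :
    SecondCountableTopology w.Completion := by
  haveI : Countable k := countable_numberField' k
  haveI : Countable (WithAbs w.1) := (WithAbs.equiv w.1).injective.countable
  haveI : SeparableSpace w.Completion :=
    ⟨⟨Set.range ((↑) : WithAbs w.1 → w.Completion), Set.countable_range _,
      InfinitePlace.Completion.denseRange_coe w⟩⟩
  exact UniformSpace.secondCountable_of_separable _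

/-- `𝔸_{k,∞}` is second countable. -/
theorem secondCountable_infiniteAdeleRing : SecondCountableTopology (InfiniteAdeleRing k) := by
  haveI : ∀ w : InfinitePlace k, SecondCountableTopology w.Completion :=
    secondCountable_infinitePlaceCompletion k
  exact inferInstanceAs (SecondCountableTopology ((w : InfinitePlace k) → w.Completion))

/-- The completion of `k` at a finite place is second countable (separable: `k` is countable and dense). -/
theorem secondCountable_adicCompletion (v : HeightOneSpectrum (𝓞 k)) :
    SecondCountableTopology (v.adicCompletion k) := by
  haveI : Countable k := countable_numberField' k
  haveI : SeparableSpace (v.adicCompletion k) :=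
    ⟨⟨Set.range (algebraMap k (v.adicCompletion k)), Set.countable_range _, denseRange_algebraMap k v⟩⟩
  exact UniformSpace.secondCountable_of_separable _

/-- The non-zero primes of `𝓞_k` are countable (every ideal of the Noetherian countable ring `𝓞_k` is the span of a
finite set). -/
theorem countable_heightOneSpectrum : Countable (HeightOneSpectrum (𝓞 k)) := by
  haveI : Countable (𝓞 k) := Finsupp.Countable.of_moduleFinite (R := ℤ)
  have hsurj : Function.Surjective (fun s : Finset (𝓞 k) => Ideal.span (s : Set (𝓞 k))) := by
    intro I
    obtain ⟨s, hs⟩ := IsNoetherian.noetherian I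
    exact ⟨s, hs⟩
  haveI : Countable (Ideal (𝓞 k)) := hsurj.countable
  exact Function.Injective.countable (f := fun v : HeightOneSpectrum (𝓞 k) => v.asIdeal)
    (fun a b h => HeightOneSpectrum.ext h)

open scoped RestrictedProduct in
/-- **The finite adele ring is second countable.** -/
theorem secondCountable_finiteAdeleRing : SecondCountableTopology (FiniteAdeleRing (𝓞 k) k) := by
  haveI := countable_heightOneSpectrum k
  haveI : ∀ v : HeightOneSpectrum (𝓞 k), SecondCountableTopology (v.adicCompletion k) :=
    secondCountable_adicCompletion k
  exact secondCountableTopology_restrictedProduct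
    (R := fun v : HeightOneSpectrum (𝓞 k) => v.adicCompletion k)
    (A := fun v => (v.adicCompletionIntegers k : Set (v.adicCompletion k)))
    (fun v => Valued.isOpen_valuationSubring _)

/-- **The adele ring is second countable.** -/
theorem secondCountable_adeleRing : SecondCountableTopology (AdeleRing (𝓞 k) k) :=
  haveI := secondCountable_infiniteAdeleRing k
  haveI := secondCountable_finiteAdeleRing k
  inferInstanceAs (SecondCountableTopology (InfiniteAdeleRing k × FiniteAdeleRing (𝓞 k) k))

/-- `GL₄(𝔸_k)` is second countable (embedded in `M₄(𝔸_k) × M₄(𝔸_k)ᵐᵒᵖ`). -/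
theorem secondCountable_GL4 : SecondCountableTopology (GL4 k) := by
  haveI := secondCountable_adeleRing k
  haveI : SecondCountableTopology (M4 k) :=
    inferInstanceAs (SecondCountableTopology (Fin 4 → Fin 4 → Ad k))
  haveI : SecondCountableTopology (M4 k)ᵐᵒᵖ :=
    (MulOpposite.opHomeomorph : M4 k ≃ₜ (M4 k)ᵐᵒᵖ).symm.isEmbedding.secondCountableTopology
  exact (Units.isEmbedding_embedProduct (M := M4 k)).secondCountableTopology

end Adeles

section Instance

variable {k : Type} [Field k] [NumberField k] (W : PlaneData k)

/-- (I1-h, LINE L1, Skeleton v0.11 L716): **`U(W)(𝔸_k)` is second countable** — a subspace of `GL₄(𝔸_k)`. -/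
theorem secondCountable_GA : SecondCountableTopology (GA W) := by
  haveI := secondCountable_GL4 k
  exact IsEmbedding.subtypeVal.secondCountableTopology

end Instance

end Summit.Ventures.HodgeRepro.Tier4.Line1

end
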